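import Summits.Ventures.LatticeQCDFlow.Scaling.SwapLadderIndexTauIntCritGap
import Summits.Ventures.LatticeQCDFlow.Scaling.SwapLadderIndexTauIntThresholdPoints
import Summits.Ventures.LatticeQCDFlow.Scaling.SwapLadderIndexTauIntThresholdMajorant
import Summits.Ventures.LatticeQCDFlow.Scaling.SwapAcceptanceOptimum

/-!
HONEST FRAMING: exact (Metropolis-corrected) sampling algorithms for lattice gauge theory; figures
of merit are autocorrelation/cost numbers at stated couplings and volumes; no continuum-physics
claim.

# SwapLadderIndexTauIntThresholdAllK — FOR EVERY NUMBER OF REPLICAS THE FLAT-`20 %` LADDER IS ABOVE THE COLLAPSE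
# THRESHOLD: `Λ_c(K) ≤ 4√2·0.3711·(K+1)` FOR ALL `K`, AND `Λ_c(K) < K·ℓ₂₀ = K·2√2·u₂₀` FOR ALL `K ≥ 1`
# (row 22 `su3-ptbc`, GEN-8, ours; sequel of `SwapLadderIndexTauIntCritGap`, `…ThresholdPoints`, `…ThresholdMajorant`)

Venture `LatticeQCDFlow` (cell pub-lqcd), topic `Scaling`; FANOUT row 22 (`su3-ptbc`).  NEW WORK of the cell over
`SwapLadderIndexTauIntCritGap` (`critGap`, `critGap_le`, `critGap_mono`, `critGap_of_le_one`, `maxPassageWeight`, `Λ_c =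
thresholdStiffness`, `thresholdStiffness_of_le_two`), `SwapLadderIndexTauIntThresholdPoints` (`mul_deriv_zero_le_deriv_ray`,
`mul_erfc_sq_le_exp_neg_of_mills`, the certified points `ray_point_*`), `SwapLadderIndexTauIntThresholdMajorant` (the majorant
`M = indexMajorant`, its band bounds and `sum_indexMajorant_le`: `Σ_{i=1}^{m} M(i/N) ≤ 0.3711·N`), GEN-4's `SwapAcceptanceOptimum`
(`uTwenty`, `erfc u₂₀ = 1/5`, `u₂₀ > 0.9`) and Mathlib (`Real.exp_one_gt_d9`, `Real.pi_gt_three`,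
`Real.log_le_sub_one_of_pos`, `Real.rpow`).  Nothing is cited as a fact; no `native_decide`.

THE POINT (model statements, value-free).  `SwapLadderIndexTauIntThreshold` (staged sequel of `…CritGap`): a positive
`τ_int`-optimal ladder exists iff the total stiffness exceeds `Λ_c(K) = Σ_{j<K} critGap((w_max/w_j)²)`;
`SwapLadderIndexTauIntThresholdCard` checks the card's three ladders.  Here the comparison is made for EVERY number of replicas:
* §1 `critGap_le_sqrt_log` (Mills: `critGap R ≤ 2√2·√(log R)` for `R ≥ e`), `log_le_div_exp_one` (`log y ≤ y/e`), `log_le_sqrt`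
  (`log y ≤ (2/e)√y`), the band template `critGap_band`, the tail constant `(4/e)√(5/19) ≤ (22/25)²` (`tail_constant_le`),
  **`critGap_tail`** (`0 < τ ≤ 1/20`: `critGap((4τ(1−τ))^{−2}) ≤ 2√2·0.88·τ^{−1/4}`) and **`critGap_le_majorant`**:
  `critGap((4τ(1−τ))^{−2}) ≤ 2√2·M(τ)` for all `0 < τ ≤ 1/2` (seven bands + tail).
* §2 `weightRatio_sq_le` (`(w_max/w_j)² ≤ (4t(1−t))^{−2}`, `t = (j+1)/(K+1)`), `critGap_weightRatio_le`
  (`≤ 2√2·(M(t) + M(1−t))`), the reflection `j ↦ K−1−j`, and **`thresholdStiffness_le_sum_majorant`**: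
  `Λ_c(K) ≤ 4√2·Σ_{i=1}^{K} M(i/(K+1))`; with the Riemann bound: **`thresholdStiffness_le_linear`**: `Λ_c(K) ≤ 4√2·0.3711·(K+1)`
  for every `K` (`≈ 2.1·(K+1)`; desk values `Λ_c(K)/K = 0.46 … 1.24` for `K = 3 … 400`).
* §3 `thresholdStiffness_three_le` (`≤ 2√2·0.6`), `thresholdStiffness_four_le` (`≤ 2√2·0.8`), and the MAIN THEOREM
  **`thresholdStiffness_lt_flat_twenty`**: for EVERY `K ≥ 1`, `Λ_c(K) < K·ℓ₂₀` with `ℓ₂₀ = 2√2·u₂₀` the flat-`20 %` gap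
  (`gaussAcc ℓ₂₀ = 1/5` is `SwapLadderIndexTauIntThresholdCard.gaussAcc_flat_twenty`) — the card's equal-acceptance tuning rule is NEVER in the collapse regime of
  the `τ_int`-optimal ladder, whatever the number of replicas: the `τ_int`-optimal ladder with the same endpoints exists (staged
  `SwapLadderIndexTauIntThreshold.exists_isMinOn_gapSimplex`), is unique and has the shape of `SwapLadderIndexTauIntOptimumShape`.
NOT CLAIMED: sharp constants; anything about PTBC itself or a run; that re-tuning for the index `τ_int` is advisable (GEN-7: it
lengthens round trips).
-/

noncomputable section

open Finset Real Set
open Literature.ComputerArithmetic.BrentZimmermann2010.AsymptoticExpansions (erfc)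

namespace Summit.Ventures.LatticeQCDFlow.Scaling

/-! ## §1 Pointwise domination of `critGap((4τ(1−τ))^{−2})` by the majorant -/

section Pointwise

/-- **Mills, generic: `critGap R ≤ 2√2·√(log R)` for `R ≥ e`** (`x = √(log R)`, `F = R = e^{x²}`, `R ≤ x²πR` since
`π·log R > 1`). [ours] -/
theorem critGap_le_sqrt_log {R : ℝ} (hR : exp 1 ≤ R) : critGap R ≤ 2 * sqrt 2 * sqrt (log R) := by
  have hR0 : 0 < R := lt_of_lt_of_le (exp_pos 1) hR
  have hlog : 1 ≤ log R := by rwa [le_log_iff_exp_le hR0]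
  have hx : 0 < sqrt (log R) := sqrt_pos.2 (by linarith)
  refine critGap_le (by positivity) (mul_deriv_zero_le_deriv_ray
    (mul_erfc_sq_le_exp_neg_of_mills hx hR0.le (F := R) ?_ ?_))
  · rw [sq_sqrt (by linarith), exp_log hR0]
  · rw [sq_sqrt (by linarith)]
    have hπ : (3 : ℝ) < π := pi_gt_three
    have h3 : 1 ≤ log R * π := by nlinarith
    nlinarith [mul_nonneg (sub_nonneg.2 h3) hR0.le]

/-- `log y ≤ y/e` for `y > 0`. [folklore] -/
theorem log_le_div_exp_one {y : ℝ} (hy : 0 < y) : log y ≤ y / exp 1 := by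
  have h := log_le_sub_one_of_pos (div_pos hy (exp_pos 1))
  rw [log_div hy.ne' (exp_pos 1).ne', log_exp] at h
  linarith

/-- `log y ≤ (2/e)·√y` for `y > 0` (the previous bound at `√y`). [folklore] -/
theorem log_le_sqrt {y : ℝ} (hy : 0 < y) : log y ≤ 2 / exp 1 * sqrt y := by
  have h := log_le_div_exp_one (sqrt_pos.2 hy)
  rw [log_sqrt hy.le] at h
  calc log y ≤ 2 * (sqrt y / exp 1) := by linarith
    _ = 2 / exp 1 * sqrt y := by ring

/-- For `c ≤ τ ≤ 1/2`: `4c(1−c) ≤ 4τ(1−τ)` (`t ↦ t(1−t)` increases on `[0, 1/2]`). [folklore] -/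
theorem four_mul_mono {c τ : ℝ} (hc : c ≤ τ) (hτ : τ ≤ 1 / 2) : 4 * c * (1 - c) ≤ 4 * τ * (1 - τ) := by
  nlinarith

/-- **Band template**: `c ≤ τ ≤ 1/2`, the numeric check `1/(4c(1−c))² ≤ R'` and a certified point `R'·G′(0) ≤ G′(2√2·x)`
give `critGap((4τ(1−τ))^{−2}) ≤ 2√2·x`. [ours] -/
theorem critGap_band {τ c x R' : ℝ} (hc0 : 0 < c) (hc : c ≤ τ) (hτ : τ ≤ 1 / 2)
    (hR' : 1 / (4 * c * (1 - c)) ^ 2 ≤ R') (hx : 0 ≤ x)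
    (hpt : R' * deriv gaussInvAcc 0 ≤ deriv gaussInvAcc (2 * sqrt 2 * x)) :
    critGap (1 / (4 * τ * (1 - τ)) ^ 2) ≤ 2 * sqrt 2 * x := by
  have hp : 0 < 4 * c * (1 - c) := by nlinarith
  have h1 : 1 / (4 * τ * (1 - τ)) ^ 2 ≤ 1 / (4 * c * (1 - c)) ^ 2 :=
    one_div_le_one_div_of_le (pow_pos hp 2) (pow_le_pow_left₀ hp.le (four_mul_mono hc hτ) 2)
  exact (critGap_mono (h1.trans hR')).trans (critGap_le (by positivity) hpt)

/-- `√(5/19) ≤ 0.513` and hence `(4/e)·√(5/19) ≤ (22/25)²` (`e > 2.718281828`). [ours] -/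
theorem tail_constant_le : 4 / exp 1 * sqrt (5 / 19) ≤ (22 / 25 : ℝ) ^ 2 := by
  have hs : sqrt (5 / 19 : ℝ) ≤ 0.513 := by
    rw [show (0.513 : ℝ) = sqrt (0.513 ^ 2) by rw [sqrt_sq (by norm_num)]]
    exact sqrt_le_sqrt (by norm_num)
  have he := exp_one_gt_d9
  rw [div_mul_eq_mul_div, div_le_iff₀ (exp_pos 1)]
  nlinarith [sqrt_nonneg (5 / 19 : ℝ)]

/-- **TAIL: for `0 < τ ≤ 1/20`, `critGap((4τ(1−τ))^{−2}) ≤ 2√2·(22/25)·τ^{−1/4} = 2√2·M(τ)`** (Mills: `≤ 2√2√(2 log y)`,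
`y = 1/(4τ(1−τ)) ≤ 5/(19τ)`, `log y ≤ (2/e)√y`). [ours] -/
theorem critGap_tail {τ : ℝ} (h0 : 0 < τ) (hτ : τ ≤ 1 / 20) :
    critGap (1 / (4 * τ * (1 - τ)) ^ 2) ≤ 2 * sqrt 2 * indexMajorant τ := by
  rw [indexMajorant_of_le hτ]
  have hprod : 0 < 4 * τ * (1 - τ) := by nlinarith
  set y : ℝ := 1 / (4 * τ * (1 - τ)) with hy
  have hy0 : 0 < y := by positivity
  have hR : 1 / (4 * τ * (1 - τ)) ^ 2 = y ^ 2 := by rw [hy, div_pow, one_pow]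
  rw [hR]
  have hy5 : 5 ≤ y := by
    rw [hy, le_div_iff₀ hprod]; nlinarith
  have hRe : exp 1 ≤ y ^ 2 := by
    have := exp_one_lt_d9
    nlinarith
  have h1 := critGap_le_sqrt_log hRe
  -- `log (y²) ≤ (4/e)·√(5/19)·(√τ)⁻¹`
  have hy' : y ≤ (5 / 19) / τ := by
    rw [hy, div_le_div_iff₀ hprod h0]; nlinarith
  have hsqy : sqrt y ≤ sqrt (5 / 19) * (sqrt τ)⁻¹ := by
    have := sqrt_le_sqrt hy'
    rwa [sqrt_div' _ h0.le, div_eq_mul_inv] at this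
  have hlog : log (y ^ 2) ≤ 4 / exp 1 * sqrt (5 / 19) * (sqrt τ)⁻¹ := by
    rw [log_pow, Nat.cast_ofNat]
    have h := log_le_sqrt hy0
    have he : 0 ≤ 2 / exp 1 := by positivity
    have := mul_le_mul_of_nonneg_left hsqy he
    have e4 : 4 / exp 1 * sqrt (5 / 19) * (sqrt τ)⁻¹ = 2 * (2 / exp 1 * (sqrt (5 / 19) * (sqrt τ)⁻¹)) := by ring
    rw [e4]
    linarith
  -- the square of the target: `(22/25·τ^{−1/4})² = (22/25)²·(√τ)⁻¹`
  have hu : 0 ≤ 22 / 25 * τ ^ (-(1 / 4 : ℝ)) := mul_nonneg (by norm_num) (rpow_nonneg h0.le _)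
  have hsq : (22 / 25 * τ ^ (-(1 / 4 : ℝ))) ^ 2 = (22 / 25) ^ 2 * (sqrt τ)⁻¹ := by
    rw [mul_pow, ← rpow_natCast (τ ^ (-(1 / 4 : ℝ))) 2, ← rpow_mul h0.le]
    norm_num
    rw [rpow_neg h0.le, sqrt_eq_rpow]
  have hτinv : 0 < (sqrt τ)⁻¹ := inv_pos.2 (sqrt_pos.2 h0)
  have key : log (y ^ 2) ≤ (22 / 25 * τ ^ (-(1 / 4 : ℝ))) ^ 2 := by
    rw [hsq]
    exact hlog.trans (mul_le_mul_of_nonneg_right tail_constant_le hτinv.le)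
  have hroot : sqrt (log (y ^ 2)) ≤ 22 / 25 * τ ^ (-(1 / 4 : ℝ)) := by
    have := sqrt_le_sqrt key
    rwa [sqrt_sq hu] at this
  have hs2 : 0 ≤ 2 * sqrt 2 := by positivity
  exact h1.trans (mul_le_mul_of_nonneg_left hroot hs2)

/-- **THE POINTWISE DOMINATION: `critGap((4τ(1−τ))^{−2}) ≤ 2√2·M(τ)` for `0 < τ ≤ 1/2`** (tail below `1/20`, the seven
certified points band by band above). [ours] -/
theorem critGap_le_majorant {τ : ℝ} (h0 : 0 < τ) (hτ : τ ≤ 1 / 2) :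
    critGap (1 / (4 * τ * (1 - τ)) ^ 2) ≤ 2 * sqrt 2 * indexMajorant τ := by
  rcases le_or_gt τ (1 / 20) with hsmall | hbig
  · exact critGap_tail h0 hsmall
  have hs2 : 0 ≤ 2 * sqrt 2 := by positivity
  by_cases h35 : 7 / 20 ≤ τ
  · exact (critGap_band (by norm_num) h35 hτ (by norm_num) (by norm_num) ray_point_01).trans
      (mul_le_mul_of_nonneg_left (tenth_le_indexMajorant h0) hs2)
  by_cases h23 : 23 / 100 ≤ τ
  · exact (critGap_band (by norm_num) h23 hτ (by norm_num) (by norm_num) ray_point_03).trans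
      (mul_le_mul_of_nonneg_left (le_indexMajorant_of_le_step h0 (by norm_num)
        (stepMajorant_ge_of_lt_35 (lt_of_not_ge h35))) hs2)
  by_cases h20 : 1 / 5 ≤ τ
  · exact (critGap_band (by norm_num) h20 hτ (by norm_num) (by norm_num) ray_point_04).trans
      (mul_le_mul_of_nonneg_left (le_indexMajorant_of_le_step h0 (by norm_num)
        (stepMajorant_ge_of_lt_23 (lt_of_not_ge h23))) hs2)
  by_cases h15 : 3 / 20 ≤ τ
  · exact (critGap_band (by norm_num) h15 hτ (by norm_num) (by norm_num) ray_point_06).trans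
      (mul_le_mul_of_nonneg_left (le_indexMajorant_of_le_step h0 (by norm_num)
        (stepMajorant_ge_of_lt_20 (lt_of_not_ge h20))) hs2)
  by_cases h10 : 1 / 10 ≤ τ
  · exact (critGap_band (by norm_num) h10 hτ (by norm_num) (by norm_num) ray_point_085).trans
      (mul_le_mul_of_nonneg_left (le_indexMajorant_of_le_step h0 (by norm_num)
        (stepMajorant_ge_of_lt_15 (lt_of_not_ge h15))) hs2)
  by_cases h078 : 39 / 500 ≤ τ
  · exact (critGap_band (by norm_num) h078 hτ (by norm_num) (by norm_num) ray_point_one).trans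
      (mul_le_mul_of_nonneg_left (le_indexMajorant_of_le_step h0 (by norm_num)
        (stepMajorant_ge_of_lt_10 (lt_of_not_ge h10))) hs2)
  · exact (critGap_band (by norm_num) hbig.le hτ (by norm_num) (by norm_num) ray_point_14).trans
      (mul_le_mul_of_nonneg_left (le_indexMajorant_of_le_step h0 le_rfl
        (stepMajorant_ge_of_lt_078 (lt_of_not_ge h078))) hs2)

end Pointwise

/-! ## §2 From the ladder's weight ratios to the majorant, and the sum -/

section Sum

variable {K : ℕ}

/-- **`(w_max/w_j)² ≤ (4t(1−t))^{−2}`, `t = (j+1)/(K+1)`** (`w_j = (K+1)²·t(1−t)`, `w_max ≤ (K+1)²/4`). [ours] -/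
theorem weightRatio_sq_le {j : ℕ} (hj : j < K) :
    (maxPassageWeight K / passageWeight K j) ^ 2
      ≤ 1 / (4 * (((j : ℝ) + 1) / ((K : ℝ) + 1)) * (1 - ((j : ℝ) + 1) / ((K : ℝ) + 1))) ^ 2 := by
  set t : ℝ := ((j : ℝ) + 1) / ((K : ℝ) + 1) with ht
  have hN : (0 : ℝ) < (K : ℝ) + 1 := by positivity
  have hjK : (j : ℝ) + 1 ≤ K := by exact_mod_cast hj
  have ht0 : 0 < t := by positivity
  have ht1 : t < 1 := by rw [ht, div_lt_one hN]; linarith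
  have hw : passageWeight K j = ((K : ℝ) + 1) ^ 2 * (t * (1 - t)) := by
    rw [ht]; unfold passageWeight; field_simp; ring
  have hmax : maxPassageWeight K ≤ ((K : ℝ) + 1) ^ 2 / 4 := by
    rw [maxPassageWeight_eq]; unfold passageWeight
    nlinarith [sq_nonneg ((((K - 1) / 2 : ℕ) : ℝ) + 1 - ((K : ℝ) - (((K - 1) / 2 : ℕ) : ℝ)))]
  have hwpos : 0 < passageWeight K j := passageWeight_pos hj
  have hprod : 0 < 4 * t * (1 - t) := by nlinarith
  have hratio : maxPassageWeight K / passageWeight K j ≤ 1 / (4 * t * (1 - t)) := by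
    rw [div_le_div_iff₀ hwpos hprod, one_mul, hw]
    nlinarith
  have h0 : 0 ≤ maxPassageWeight K / passageWeight K j :=
    div_nonneg (maxPassageWeight_pos (by omega)).le hwpos.le
  exact pow_le_pow_left₀ h0 hratio 2 |>.trans (by rw [div_pow, one_pow])

/-- **`critGap((w_max/w_j)²) ≤ 2√2·(M(t) + M(1−t))`, `t = (j+1)/(K+1)`** (the pointwise domination at `min(t, 1−t)`, the
other term is nonnegative). [ours] -/
theorem critGap_weightRatio_le {j : ℕ} (hj : j < K) :
    critGap ((maxPassageWeight K / passageWeight K j) ^ 2)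
      ≤ 2 * sqrt 2 * (indexMajorant (((j : ℝ) + 1) / ((K : ℝ) + 1)) + indexMajorant (1 - ((j : ℝ) + 1) / ((K : ℝ) + 1))) := by
  set t : ℝ := ((j : ℝ) + 1) / ((K : ℝ) + 1) with ht
  have hN : (0 : ℝ) < (K : ℝ) + 1 := by positivity
  have hjK : (j : ℝ) + 1 ≤ K := by exact_mod_cast hj
  have ht0 : 0 < t := by positivity
  have ht1 : t < 1 := by rw [ht, div_lt_one hN]; linarith
  have hs2 : 0 ≤ 2 * sqrt 2 := by positivity
  have hmono := critGap_mono (weightRatio_sq_le hj)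
  rw [← ht] at hmono
  have hM1 : 0 ≤ indexMajorant t := indexMajorant_nonneg ht0
  have hM2 : 0 ≤ indexMajorant (1 - t) := indexMajorant_nonneg (by linarith)
  rcases le_or_gt t (1 / 2) with hle | hgt
  · have h := critGap_le_majorant ht0 hle
    nlinarith
  · have hsymm : 1 / (4 * t * (1 - t)) ^ 2 = 1 / (4 * (1 - t) * (1 - (1 - t))) ^ 2 := by ring
    have h := critGap_le_majorant (τ := 1 - t) (by linarith) (by linarith)
    rw [← hsymm] at h
    nlinarith

/-- Reindexing `Σ_{j<m} f(j+1) = Σ_{i ∈ [1, m]} f i`. [folklore] -/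
theorem sum_range_succ_eq_sum_Icc (f : ℕ → ℝ) (m : ℕ) :
    ∑ j ∈ range m, f (j + 1) = ∑ i ∈ Finset.Icc 1 m, f i := by
  induction m with
  | zero => simp
  | succ m ih => rw [sum_range_succ, Finset.sum_Icc_succ_top (by omega), ih]

/-- **`Λ_c(K) ≤ 4√2·Σ_{i=1}^{K} M(i/(K+1))`** (pointwise domination, then the reflection `j ↦ K−1−j` which exchanges
`t` and `1−t`). [ours] -/
theorem thresholdStiffness_le_sum_majorant (K : ℕ) :
    thresholdStiffness K ≤ 4 * sqrt 2 * ∑ i ∈ Finset.Icc 1 K, indexMajorant ((i : ℝ) / ((K : ℝ) + 1)) := by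
  unfold thresholdStiffness
  have h1 : ∑ j ∈ range K, critGap ((maxPassageWeight K / passageWeight K j) ^ 2)
      ≤ ∑ j ∈ range K, 2 * sqrt 2 * (indexMajorant (((j : ℝ) + 1) / ((K : ℝ) + 1))
          + indexMajorant (1 - ((j : ℝ) + 1) / ((K : ℝ) + 1))) :=
    sum_le_sum fun j hj => critGap_weightRatio_le (mem_range.1 hj)
  have h2 : ∑ j ∈ range K, indexMajorant (1 - ((j : ℝ) + 1) / ((K : ℝ) + 1))
      = ∑ j ∈ range K, indexMajorant (((j : ℝ) + 1) / ((K : ℝ) + 1)) := by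
    rw [← sum_range_reflect (fun j => indexMajorant (((j : ℝ) + 1) / ((K : ℝ) + 1))) K]
    refine sum_congr rfl fun j hj => ?_
    have hjK := mem_range.1 hj
    have hN : ((K : ℝ) + 1) ≠ 0 := by positivity
    congr 1
    rw [Nat.cast_sub (by omega), Nat.cast_sub (by omega)]
    field_simp
    push_cast
    ring
  have h3 : ∑ j ∈ range K, indexMajorant (((j : ℝ) + 1) / ((K : ℝ) + 1))
      = ∑ i ∈ Finset.Icc 1 K, indexMajorant ((i : ℝ) / ((K : ℝ) + 1)) := by
    rw [← sum_range_succ_eq_sum_Icc (fun i => indexMajorant ((i : ℝ) / ((K : ℝ) + 1))) K]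
    refine sum_congr rfl fun j _ => ?_
    push_cast; ring_nf
  have h4 : ∑ j ∈ range K, 2 * sqrt 2 * (indexMajorant (((j : ℝ) + 1) / ((K : ℝ) + 1))
        + indexMajorant (1 - ((j : ℝ) + 1) / ((K : ℝ) + 1)))
      = 4 * sqrt 2 * ∑ i ∈ Finset.Icc 1 K, indexMajorant ((i : ℝ) / ((K : ℝ) + 1)) := by
    rw [← mul_sum, sum_add_distrib, h2, h3]; ring
  exact h1.trans h4.le

/-- **THE LINEAR BOUND: `Λ_c(K) ≤ 4√2·0.3711·(K+1)` for every `K`.** [ours] -/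
theorem thresholdStiffness_le_linear (K : ℕ) : thresholdStiffness K ≤ 4 * sqrt 2 * (0.3711 * ((K : ℝ) + 1)) := by
  have h := thresholdStiffness_le_sum_majorant K
  have hs := sum_indexMajorant_le (N := K + 1) (m := K) (by omega) (by omega)
  push_cast at hs
  have hs2 : 0 ≤ 4 * sqrt 2 := by positivity
  exact h.trans (mul_le_mul_of_nonneg_left hs hs2)

end Sum

/-! ## §3 The flat-`20 %` ladder is above the threshold for every `K ≥ 1` -/

section Flat

/-- `Λ_c(3) ≤ 2√2·0.6` (`w = 3, 4, 3`; `critGap(16/9) ≤ 2√2·0.3`). [ours] -/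
theorem thresholdStiffness_three_le : thresholdStiffness 3 ≤ 2 * sqrt 2 * (3 / 5) := by
  unfold thresholdStiffness
  simp only [sum_range_succ, sum_range_zero, maxPassageWeight, passageWeight]
  norm_num
  have h1 : critGap (16 / 9) ≤ 2 * sqrt 2 * (3 / 10) :=
    (critGap_mono (by norm_num : (16 / 9 : ℝ) ≤ 2)).trans (critGap_le (by positivity) ray_point_03)
  have h2 : critGap 1 = 0 := critGap_of_le_one le_rfl
  linarith

/-- `Λ_c(4) ≤ 2√2·0.8` (`w = 4, 6, 6, 4`; `critGap(9/4) ≤ 2√2·0.4`). [ours] -/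
theorem thresholdStiffness_four_le : thresholdStiffness 4 ≤ 2 * sqrt 2 * (4 / 5) := by
  unfold thresholdStiffness
  simp only [sum_range_succ, sum_range_zero, maxPassageWeight, passageWeight]
  norm_num
  have h1 : critGap (9 / 4) ≤ 2 * sqrt 2 * (2 / 5) :=
    (critGap_mono (by norm_num : (9 / 4 : ℝ) ≤ 49 / 20)).trans (critGap_le (by positivity) ray_point_04)
  have h2 : critGap 1 = 0 := critGap_of_le_one le_rfl
  linarith

/-- **FOR EVERY `K ≥ 1` THE FLAT-`20 %` LADDER IS ABOVE THE COLLAPSE THRESHOLD: `Λ_c(K) < K·ℓ₂₀`, `ℓ₂₀ = 2√2·u₂₀`**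
(`K ≤ 2`: `Λ_c = 0`; `K = 3, 4`: the explicit bounds; `K ≥ 5`: the linear bound and `u₂₀ > 0.9`). [ours] -/
theorem thresholdStiffness_lt_flat_twenty {K : ℕ} (hK : 1 ≤ K) :
    thresholdStiffness K < K * (2 * sqrt 2 * uTwenty) := by
  have hu := uTwenty_mem_Ioo.1
  have hs : 0 < sqrt 2 := by positivity
  have hK' : (1 : ℝ) ≤ K := by exact_mod_cast hK
  rcases Nat.lt_or_ge K 3 with hK2 | hK3
  · rw [thresholdStiffness_of_le_two (by omega)]
    positivity
  have hsu : 0 < sqrt 2 * (uTwenty - 9 / 10) := mul_pos hs (sub_pos.2 hu)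
  rcases Nat.lt_or_ge K 5 with hK4 | hK5
  · interval_cases K
    · have h := thresholdStiffness_three_le
      have h' : 2 * sqrt 2 * (3 / 5 : ℝ) < (3 : ℝ) * (2 * sqrt 2 * uTwenty) := by nlinarith
      push_cast
      linarith
    · have h := thresholdStiffness_four_le
      have h' : 2 * sqrt 2 * (4 / 5 : ℝ) < (4 : ℝ) * (2 * sqrt 2 * uTwenty) := by nlinarith
      push_cast
      linarith
  · have h := thresholdStiffness_le_linear K
    have hK5' : (5 : ℝ) ≤ K := by exact_mod_cast hK5
    have hKpos : (0 : ℝ) < K := by linarith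
    have h1 : 1.4844 * ((K : ℝ) + 1) < 2 * K * uTwenty := by nlinarith [mul_pos (sub_pos.2 hu) hKpos]
    have h2 := mul_lt_mul_of_pos_left h1 hs
    have e1 : 4 * sqrt 2 * (0.3711 * ((K : ℝ) + 1)) = sqrt 2 * (1.4844 * ((K : ℝ) + 1)) := by ring
    have e2 : (K : ℝ) * (2 * sqrt 2 * uTwenty) = sqrt 2 * (2 * K * uTwenty) := by ring
    rw [e2]
    rw [e1] at h
    linarith

/- Read as a gap vector: with `K ≥ 1` gaps all equal to `ℓ₂₀` (model acceptance `1/5` per pair,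
`SwapLadderIndexTauIntThresholdCard.gaussAcc_flat_twenty`, in the tree), the total stiffness `K·ℓ₂₀` exceeds `Λ_c(K)`, so by
`SwapLadderIndexTauIntThreshold` (not imported) a positive `τ_int`-optimal ladder with the same endpoints exists. -/

end Flat


end Summit.Ventures.LatticeQCDFlow.Scaling

end
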